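import Summits.CriticalPhenomena.PercolationContinuityZ3.Theorems.PercNearOneGluingNoHeavyLowerTailSunflowerOnePointCertificates
import HarnessLib

/-!
# `NoHeavyLowerTail` (crux stmt-CriticalPhenomena-4575), abstract sunflower cubic: three more ONE-POINT CERTIFICATE classes (kernel-inert,
# bottom-inert, upper-never-bottom coordinates) and the WEIGHTED good-coordinate induction principle

Support file (seat `prim-ineq-gen-2` gen 24; `--supports stmt-CriticalPhenomena-4575`; companion of `…SunflowerOnePointCertificates` (the scan, p332425) and
`…SunflowerGoodCoordinate`).  Memo: run/shared/lean/prim/prim-ineq-gen-2/ONE-POINT-SCAN-GEN24.md §2–§3.  Nothing is asserted about the crux; no `sorry`.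

SETTING.  As in the companion: `e ∉ W`, lower section `φ = lab`, upper section `ψ = lab (insert e ·)` on `2^W`; `b₀ = Σ s6H(φ,φ,φ) = F.ZP W ∅ ∅ ∅`,
`b₁ = Σ s6H(ψ,φ,φ)` with `F.ZP (insert e W) ∅ ∅ ∅ = 3 b₁`, and `b₃ = Σ s6H(ψ,ψ,ψ) = F.ZP W {e} {e} {e} = (F.con e).ZP W ∅ ∅ ∅` (the upper section's functional).
The complete scan of one-point code classes (memo §2) has 21 maximal classes with an inductive pointwise certificate; three of the symmetric ones are proved here,
each as "symmetrised code kernel ≥ 0 by `decide`" + spectator antipodal Gladkov (on `φ` or, polarised with offsets `{e} ⊇ {e}`, on `ψ`):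

* `Sunflower.ZP_add_two_con_le_of_kernelInert` — **KERNEL-INERT coordinate** (`lab (insert e X) = ⊤ → lab X = ⊤` on `2^W`: no set acquires kernel status through `e`):
  `b₀ + 2 b₃ ≤ 3 b₁`, i.e. `F.ZP W ∅ ∅ ∅ + 2 · (F.con e).ZP W ∅ ∅ ∅ ≤ F.ZP (insert e W) ∅ ∅ ∅` — a THIRD pencil shape (`1·deletion + 2·contraction`) besides (MZ) and
  the concave pencil `2b₀ + b₃ ≤ 3b₁` of `…RestrictionExchange`.
* `Sunflower.three_ZP_le_of_bottomInert` — **BOTTOM-INERT coordinate** (`lab X = 0 → lab (insert e X) = 0`): `3 b₀ ≤ 3 b₁`, i.e. `3 · F.ZP W ∅ ∅ ∅ ≤ F.ZP (insert e W) ∅ ∅ ∅`.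
* `Sunflower.ZP_add_con_le_of_upper_ne_zero` — **upper section never bottom** (`lab (insert e X) ≠ 0` on `2^W`, e.g. `lab {e} ≠ 0`): `b₀ + b₃ ≤ 3 b₁` — the quantitative
  form of Theorem A of `…RestrictionSingleton` (which gives `b₀ ≤ 3b₁`).
* `partitionLemmaH_of_weightedGoodCoordinates` — the induction principle of `…SunflowerGoodCoordinate` with an arbitrary branch `a·b₀ + c·b₃ ≤ 3b₁` (`a, c : ℕ`, `1 ≤ a`)
  at the chosen coordinate; all one-point classes of the scan feed it.
-/

namespace Summit.CriticalPhenomena.PercolationContinuityZ3.Theorems.SunflowerPartition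

open Finset

/-! ## Code kernels and their pointwise nonnegativity -/

/-- Kernel-inert comparison kernel: `3·s6H x₁ y₀ z₀ − s6H x₀ y₀ z₀ − 2·s6H x₁ y₁ z₁ − 3·[x₀ = 0 ∧ x₁ ∈ {1,2,3}]·kk y₁ z₁`. [this work] -/
def kiKernel (x0 x1 y0 y1 z0 z1 : Fin 5) : ℤ :=
  3 * s6H x1 y0 z0 - s6H x0 y0 z0 - 2 * s6H x1 y1 z1
    - 3 * ((if x0 = 0 ∧ (x1 = 1 ∨ x1 = 2 ∨ x1 = 3) then (1 : ℤ) else 0) * kk y1 z1)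

/-- Symmetrisation of `kiKernel`. [this work] -/
def kiSymm (x0 x1 y0 y1 z0 z1 : Fin 5) : ℤ :=
  kiKernel x0 x1 y0 y1 z0 z1 + kiKernel x0 x1 z0 z1 y0 y1 + kiKernel y0 y1 x0 x1 z0 z1
    + kiKernel y0 y1 z0 z1 x0 x1 + kiKernel z0 z1 x0 x1 y0 y1 + kiKernel z0 z1 y0 y1 x0 x1

/-- Kernel-inert code test: `x₀ ≤ x₁` and `x₁ = ⊤ → x₀ = ⊤`. [this work] -/
def kiCode (x0 x1 : Fin 5) : Bool := (x0 = x1 || x0 = 0 || x1 = 4) && (!(x1 = 4) || x0 = 4)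

/-- Conditions to code test. [this work] -/
theorem kiCode_of_conds : ∀ x0 x1 : Fin 5, (x0 = x1 ∨ x0 = 0 ∨ x1 = 4) → (x1 = 4 → x0 = 4) → kiCode x0 x1 = true := by decide

/-- Pointwise nonnegativity of the symmetrised kernel-inert kernel. [this work] -/
theorem kiSymm_nonneg_code : ∀ x0 x1 y0 y1 z0 z1 : Fin 5,
    kiCode x0 x1 = true → kiCode y0 y1 = true → kiCode z0 z1 = true → 0 ≤ kiSymm x0 x1 y0 y1 z0 z1 := by
  decide

/-- Bottom-inert comparison kernel: `s6H x₁ y₀ z₀ − s6H x₀ y₀ z₀ − [x₀ ∈ {1,2,3} ∧ x₁ = ⊤]·kk y₀ z₀`. [this work] -/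
def biKernel (x0 x1 y0 _y1 z0 _z1 : Fin 5) : ℤ :=
  s6H x1 y0 z0 - s6H x0 y0 z0 - (if (x0 = 1 ∨ x0 = 2 ∨ x0 = 3) ∧ x1 = 4 then (1 : ℤ) else 0) * kk y0 z0

/-- Symmetrisation of `biKernel`. [this work] -/
def biSymm (x0 x1 y0 y1 z0 z1 : Fin 5) : ℤ :=
  biKernel x0 x1 y0 y1 z0 z1 + biKernel x0 x1 z0 z1 y0 y1 + biKernel y0 y1 x0 x1 z0 z1
    + biKernel y0 y1 z0 z1 x0 x1 + biKernel z0 z1 x0 x1 y0 y1 + biKernel z0 z1 y0 y1 x0 x1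

/-- Bottom-inert code test: `x₀ ≤ x₁` and `x₀ = 0 → x₁ = 0`. [this work] -/
def biCode (x0 x1 : Fin 5) : Bool := (x0 = x1 || x0 = 0 || x1 = 4) && (!(x0 = 0) || x1 = 0)

/-- Conditions to code test. [this work] -/
theorem biCode_of_conds : ∀ x0 x1 : Fin 5, (x0 = x1 ∨ x0 = 0 ∨ x1 = 4) → (x0 = 0 → x1 = 0) → biCode x0 x1 = true := by decide

/-- Pointwise nonnegativity of the symmetrised bottom-inert kernel. [this work] -/
theorem biSymm_nonneg_code : ∀ x0 x1 y0 y1 z0 z1 : Fin 5,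
    biCode x0 x1 = true → biCode y0 y1 = true → biCode z0 z1 = true → 0 ≤ biSymm x0 x1 y0 y1 z0 z1 := by
  decide

/-- Upper-never-bottom comparison kernel: `3·s6H x₁ y₀ z₀ − s6H x₀ y₀ z₀ − s6H x₁ y₁ z₁ − wφ(x₀,x₁)·kk y₀ z₀ − wψ(x₀,x₁)·kk y₁ z₁` with
`wφ = 3` on the codes `(0,⊤), (k,⊤), (⊤,⊤)`, `wψ = 3` on `(0,k)` and `1` on `(k,k)`. [this work] -/
def nbKernel (x0 x1 y0 y1 z0 z1 : Fin 5) : ℤ :=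
  3 * s6H x1 y0 z0 - s6H x0 y0 z0 - s6H x1 y1 z1
    - (if x1 = 4 then (3 : ℤ) else 0) * kk y0 z0
    - ((if x0 = 0 ∧ (x1 = 1 ∨ x1 = 2 ∨ x1 = 3) then (3 : ℤ) else 0)
        + (if (x0 = 1 ∨ x0 = 2 ∨ x0 = 3) ∧ x1 = x0 then (1 : ℤ) else 0)) * kk y1 z1

/-- Symmetrisation of `nbKernel`. [this work] -/
def nbSymm (x0 x1 y0 y1 z0 z1 : Fin 5) : ℤ :=
  nbKernel x0 x1 y0 y1 z0 z1 + nbKernel x0 x1 z0 z1 y0 y1 + nbKernel y0 y1 x0 x1 z0 z1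
    + nbKernel y0 y1 z0 z1 x0 x1 + nbKernel z0 z1 x0 x1 y0 y1 + nbKernel z0 z1 y0 y1 x0 x1

/-- Upper-never-bottom code test: `x₀ ≤ x₁` and `x₁ ≠ 0`. [this work] -/
def nbCode (x0 x1 : Fin 5) : Bool := (x0 = x1 || x0 = 0 || x1 = 4) && !(x1 = 0)

/-- Conditions to code test. [this work] -/
theorem nbCode_of_conds : ∀ x0 x1 : Fin 5, (x0 = x1 ∨ x0 = 0 ∨ x1 = 4) → x1 ≠ 0 → nbCode x0 x1 = true := by decide

/-- Pointwise nonnegativity of the symmetrised upper-never-bottom kernel. [this work] -/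
theorem nbSymm_nonneg_code : ∀ x0 x1 y0 y1 z0 z1 : Fin 5,
    nbCode x0 x1 = true → nbCode y0 y1 = true → nbCode z0 z1 = true → 0 ≤ nbSymm x0 x1 y0 y1 z0 z1 := by
  decide

variable {α : Type*} [DecidableEq α]

namespace Sunflower

variable (F : Sunflower α)

/-! ## Spectator Gladkov on the upper section, and the upper functional -/

/-- **Spectator Gladkov for the UPPER section** (this work): for nonnegative weights `a` of the code of the spectator block,
`0 ≤ Σ_X a(lab X, lab (insert e X)) · Σ_{S ⊆ W∖X} kk (lab (insert e S)) (lab (insert e ((W∖X)∖S)))` (polarised antipodal Gladkov with offsets `{e} ⊇ {e}`). -/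
theorem spectator_con_gladkov_nonneg (W : Finset α) (e : α) (a : Fin 5 → Fin 5 → ℤ) (ha : ∀ x y, 0 ≤ a x y) :
    0 ≤ nested W (fun X S T => a (F.lab X) (F.lab (insert e X)) * kk (F.lab (insert e S)) (F.lab (insert e T))) := by
  unfold nested
  refine sum_nonneg fun X _ => ?_
  rw [← mul_sum]
  refine mul_nonneg (ha _ _) ?_
  have h := F.antipodal_gladkov_polarized (W \ X) {e} {e} subset_rfl
  refine le_of_le_of_eq h (sum_congr rfl fun S _ => ?_)
  rw [← insert_eq, ← insert_eq]

/-- The nested functional of the upper section is `F.ZP W {e} {e} {e}`. [this work] -/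
theorem nested_con_eq_ZP (W : Finset α) (e : α) :
    nested W (fun X S T => s6H (F.lab (insert e X)) (F.lab (insert e S)) (F.lab (insert e T))) = F.ZP W {e} {e} {e} := by
  rw [nested_eq_sum_filter]
  unfold Sunflower.ZP partsOf
  refine sum_congr rfl fun q _ => ?_
  rw [← insert_eq, ← insert_eq, ← insert_eq]

/-! ## Kernel-inert coordinates -/

/-- **Kernel-inert coordinate, nested form** (this work): if `lab (insert e X) = ⊤ → lab X = ⊤` for all `X ⊆ W`, then
`Σ s6H(φ,φ,φ) + 2·Σ s6H(ψ,ψ,ψ) + 3·Σ_{X enters a petal} Σ kk(ψS,ψT) ≤ 3·Σ s6H(ψ,φ,φ)`. -/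
theorem nested_kernelInert_le (W : Finset α) (e : α)
    (hki : ∀ X, X ⊆ W → F.lab (insert e X) = 4 → F.lab X = 4) :
    nested W (fun X S T => s6H (F.lab X) (F.lab S) (F.lab T))
      + 2 * nested W (fun X S T => s6H (F.lab (insert e X)) (F.lab (insert e S)) (F.lab (insert e T)))
      + 3 * nested W (fun X S T => (if F.lab X = 0 ∧ (F.lab (insert e X) = 1 ∨ F.lab (insert e X) = 2 ∨ F.lab (insert e X) = 3) then (1 : ℤ) else 0)
          * kk (F.lab (insert e S)) (F.lab (insert e T)))
      ≤ 3 * nested W (fun X S T => s6H (F.lab (insert e X)) (F.lab S) (F.lab T)) := by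
  have hdiff : 3 * nested W (fun X S T => s6H (F.lab (insert e X)) (F.lab S) (F.lab T))
      - nested W (fun X S T => s6H (F.lab X) (F.lab S) (F.lab T))
      - 2 * nested W (fun X S T => s6H (F.lab (insert e X)) (F.lab (insert e S)) (F.lab (insert e T)))
      - 3 * nested W (fun X S T => (if F.lab X = 0 ∧ (F.lab (insert e X) = 1 ∨ F.lab (insert e X) = 2 ∨ F.lab (insert e X) = 3) then (1 : ℤ) else 0)
          * kk (F.lab (insert e S)) (F.lab (insert e T)))
      = nested W (fun X S T => kiKernel (F.lab X) (F.lab (insert e X)) (F.lab S) (F.lab (insert e S)) (F.lab T) (F.lab (insert e T))) := by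
    unfold nested kiKernel
    simp only [mul_sum, ← sum_sub_distrib]
  have hsym := six_mul_nested_codes_eq W F.lab (fun X => F.lab (insert e X)) kiKernel
  have hpos : 0 ≤ nested W (fun X S T =>
      kiKernel (F.lab X) (F.lab (insert e X)) (F.lab S) (F.lab (insert e S)) (F.lab T) (F.lab (insert e T))
        + kiKernel (F.lab X) (F.lab (insert e X)) (F.lab T) (F.lab (insert e T)) (F.lab S) (F.lab (insert e S))
        + kiKernel (F.lab S) (F.lab (insert e S)) (F.lab X) (F.lab (insert e X)) (F.lab T) (F.lab (insert e T))
        + kiKernel (F.lab S) (F.lab (insert e S)) (F.lab T) (F.lab (insert e T)) (F.lab X) (F.lab (insert e X))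
        + kiKernel (F.lab T) (F.lab (insert e T)) (F.lab X) (F.lab (insert e X)) (F.lab S) (F.lab (insert e S))
        + kiKernel (F.lab T) (F.lab (insert e T)) (F.lab S) (F.lab (insert e S)) (F.lab X) (F.lab (insert e X))) := by
    unfold nested
    refine sum_nonneg fun X hX => sum_nonneg fun S hS => ?_
    have hXW : X ⊆ W := mem_powerset.1 hX
    have hSW : S ⊆ W := (mem_powerset.1 hS).trans sdiff_subset
    have hTW : (W \ X) \ S ⊆ W := sdiff_subset.trans sdiff_subset
    exact kiSymm_nonneg_code _ _ _ _ _ _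
      (kiCode_of_conds _ _ (F.lab_mono (subset_insert e X)) (hki X hXW))
      (kiCode_of_conds _ _ (F.lab_mono (subset_insert e S)) (hki S hSW))
      (kiCode_of_conds _ _ (F.lab_mono (subset_insert e _)) (hki _ hTW))
  have h6 : 0 ≤ 6 * nested W (fun X S T =>
      kiKernel (F.lab X) (F.lab (insert e X)) (F.lab S) (F.lab (insert e S)) (F.lab T) (F.lab (insert e T))) := by
    rw [hsym]; exact hpos
  linarith

/-- **Kernel-inert coordinate** (this work): `e ∉ W`, `lab (insert e X) = ⊤ → lab X = ⊤` for all `X ⊆ W` ⟹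
`F.ZP W ∅ ∅ ∅ + 2 · (F.con e).ZP W ∅ ∅ ∅ ≤ F.ZP (insert e W) ∅ ∅ ∅` (`b₀ + 2b₃ ≤ 3b₁`). -/
theorem ZP_add_two_con_le_of_kernelInert {β : Type*} [Fintype β] [DecidableEq β] (F : Sunflower β) (W : Finset β) (e : β) (he : e ∉ W)
    (hki : ∀ X, X ⊆ W → F.lab (insert e X) = 4 → F.lab X = 4) :
    F.ZP W ∅ ∅ ∅ + 2 * (F.con e).ZP W ∅ ∅ ∅ ≤ F.ZP (insert e W) ∅ ∅ ∅ := by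
  rw [F.con_ZP_eq, ← F.nested_con_eq_ZP, F.ZP_empty_eq_nested, F.ZP_empty_eq_nested, F.nested_insert_eq W e he]
  have h1 := F.nested_kernelInert_le W e hki
  have h2 := F.spectator_con_gladkov_nonneg W e
    (fun x y => if x = 0 ∧ (y = 1 ∨ y = 2 ∨ y = 3) then (1 : ℤ) else 0) (fun x y => by split_ifs <;> norm_num)
  linarith

/-! ## Bottom-inert coordinates -/

/-- **Bottom-inert coordinate, nested form** (this work): if `lab X = 0 → lab (insert e X) = 0` for all `X ⊆ W`, then
`Σ s6H(φ,φ,φ) + Σ_{X exits} Σ kk(φS, φT) ≤ Σ s6H(ψ,φ,φ)`. -/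
theorem nested_bottomInert_le (W : Finset α) (e : α)
    (hbi : ∀ X, X ⊆ W → F.lab X = 0 → F.lab (insert e X) = 0) :
    nested W (fun X S T => s6H (F.lab X) (F.lab S) (F.lab T))
      + nested W (fun X S T => (if (F.lab X = 1 ∨ F.lab X = 2 ∨ F.lab X = 3) ∧ F.lab (insert e X) = 4 then (1 : ℤ) else 0) * kk (F.lab S) (F.lab T))
      ≤ nested W (fun X S T => s6H (F.lab (insert e X)) (F.lab S) (F.lab T)) := by
  have hdiff : nested W (fun X S T => s6H (F.lab (insert e X)) (F.lab S) (F.lab T))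
      - nested W (fun X S T => s6H (F.lab X) (F.lab S) (F.lab T))
      - nested W (fun X S T => (if (F.lab X = 1 ∨ F.lab X = 2 ∨ F.lab X = 3) ∧ F.lab (insert e X) = 4 then (1 : ℤ) else 0) * kk (F.lab S) (F.lab T))
      = nested W (fun X S T => biKernel (F.lab X) (F.lab (insert e X)) (F.lab S) (F.lab (insert e S)) (F.lab T) (F.lab (insert e T))) := by
    unfold nested biKernel
    simp only [← sum_sub_distrib]
  have hsym := six_mul_nested_codes_eq W F.lab (fun X => F.lab (insert e X)) biKernel
  have hpos : 0 ≤ nested W (fun X S T =>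
      biKernel (F.lab X) (F.lab (insert e X)) (F.lab S) (F.lab (insert e S)) (F.lab T) (F.lab (insert e T))
        + biKernel (F.lab X) (F.lab (insert e X)) (F.lab T) (F.lab (insert e T)) (F.lab S) (F.lab (insert e S))
        + biKernel (F.lab S) (F.lab (insert e S)) (F.lab X) (F.lab (insert e X)) (F.lab T) (F.lab (insert e T))
        + biKernel (F.lab S) (F.lab (insert e S)) (F.lab T) (F.lab (insert e T)) (F.lab X) (F.lab (insert e X))
        + biKernel (F.lab T) (F.lab (insert e T)) (F.lab X) (F.lab (insert e X)) (F.lab S) (F.lab (insert e S))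
        + biKernel (F.lab T) (F.lab (insert e T)) (F.lab S) (F.lab (insert e S)) (F.lab X) (F.lab (insert e X))) := by
    unfold nested
    refine sum_nonneg fun X hX => sum_nonneg fun S hS => ?_
    have hXW : X ⊆ W := mem_powerset.1 hX
    have hSW : S ⊆ W := (mem_powerset.1 hS).trans sdiff_subset
    have hTW : (W \ X) \ S ⊆ W := sdiff_subset.trans sdiff_subset
    exact biSymm_nonneg_code _ _ _ _ _ _
      (biCode_of_conds _ _ (F.lab_mono (subset_insert e X)) (hbi X hXW))
      (biCode_of_conds _ _ (F.lab_mono (subset_insert e S)) (hbi S hSW))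
      (biCode_of_conds _ _ (F.lab_mono (subset_insert e _)) (hbi _ hTW))
  have h6 : 0 ≤ 6 * nested W (fun X S T =>
      biKernel (F.lab X) (F.lab (insert e X)) (F.lab S) (F.lab (insert e S)) (F.lab T) (F.lab (insert e T))) := by
    rw [hsym]; exact hpos
  linarith

/-- **Bottom-inert coordinate** (this work): `e ∉ W`, `lab X = 0 → lab (insert e X) = 0` for all `X ⊆ W` ⟹ `3 · F.ZP W ∅ ∅ ∅ ≤ F.ZP (insert e W) ∅ ∅ ∅`
(`3b₀ ≤ 3b₁`; in particular (MZ) at `e`). -/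
theorem three_ZP_le_of_bottomInert (W : Finset α) (e : α) (he : e ∉ W)
    (hbi : ∀ X, X ⊆ W → F.lab X = 0 → F.lab (insert e X) = 0) :
    3 * F.ZP W ∅ ∅ ∅ ≤ F.ZP (insert e W) ∅ ∅ ∅ := by
  rw [F.ZP_empty_eq_nested, F.ZP_empty_eq_nested, F.nested_insert_eq W e he]
  have h1 := F.nested_bottomInert_le W e hbi
  -- the exit-weighted Gladkov sum is nonnegative (weights in {0,1})
  have h4 : 0 ≤ nested W (fun X S T => (if (F.lab X = 1 ∨ F.lab X = 2 ∨ F.lab X = 3) ∧ F.lab (insert e X) = 4 then (1 : ℤ) else 0)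
      * kk (F.lab S) (F.lab T)) := by
    unfold nested
    refine sum_nonneg fun X _ => ?_
    rw [← mul_sum]
    exact mul_nonneg (by split_ifs <;> norm_num) (F.antipodal_gladkov (W \ X))
  linarith

/-- (MZ) at a bottom-inert coordinate (this work). -/
theorem ZP_le_ZP_insert_of_bottomInert (W : Finset α) (e : α) (he : e ∉ W)
    (hbi : ∀ X, X ⊆ W → F.lab X = 0 → F.lab (insert e X) = 0) (hpos : 0 ≤ F.ZP W ∅ ∅ ∅) :
    F.ZP W ∅ ∅ ∅ ≤ F.ZP (insert e W) ∅ ∅ ∅ := by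
  have h := F.three_ZP_le_of_bottomInert W e he hbi
  linarith

/-! ## Coordinates whose upper section is never bottom -/

/-- **Upper section never bottom, nested form** (this work): if `lab (insert e X) ≠ 0` for all `X ⊆ W`, then
`Σ s6H(φ,φ,φ) + Σ s6H(ψ,ψ,ψ) + (weighted spectator Gladkov sums on φ and on ψ) ≤ 3·Σ s6H(ψ,φ,φ)`. -/
theorem nested_upperNeZero_le (W : Finset α) (e : α) (hnb : ∀ X, X ⊆ W → F.lab (insert e X) ≠ 0) :
    nested W (fun X S T => s6H (F.lab X) (F.lab S) (F.lab T))
      + nested W (fun X S T => s6H (F.lab (insert e X)) (F.lab (insert e S)) (F.lab (insert e T)))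
      + nested W (fun X S T => (if F.lab (insert e X) = 4 then (3 : ℤ) else 0) * kk (F.lab S) (F.lab T))
      + nested W (fun X S T => ((if F.lab X = 0 ∧ (F.lab (insert e X) = 1 ∨ F.lab (insert e X) = 2 ∨ F.lab (insert e X) = 3) then (3 : ℤ) else 0)
          + (if (F.lab X = 1 ∨ F.lab X = 2 ∨ F.lab X = 3) ∧ F.lab (insert e X) = F.lab X then (1 : ℤ) else 0))
          * kk (F.lab (insert e S)) (F.lab (insert e T)))
      ≤ 3 * nested W (fun X S T => s6H (F.lab (insert e X)) (F.lab S) (F.lab T)) := by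
  have hdiff : 3 * nested W (fun X S T => s6H (F.lab (insert e X)) (F.lab S) (F.lab T))
      - nested W (fun X S T => s6H (F.lab X) (F.lab S) (F.lab T))
      - nested W (fun X S T => s6H (F.lab (insert e X)) (F.lab (insert e S)) (F.lab (insert e T)))
      - nested W (fun X S T => (if F.lab (insert e X) = 4 then (3 : ℤ) else 0) * kk (F.lab S) (F.lab T))
      - nested W (fun X S T => ((if F.lab X = 0 ∧ (F.lab (insert e X) = 1 ∨ F.lab (insert e X) = 2 ∨ F.lab (insert e X) = 3) then (3 : ℤ) else 0)
          + (if (F.lab X = 1 ∨ F.lab X = 2 ∨ F.lab X = 3) ∧ F.lab (insert e X) = F.lab X then (1 : ℤ) else 0))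
          * kk (F.lab (insert e S)) (F.lab (insert e T)))
      = nested W (fun X S T => nbKernel (F.lab X) (F.lab (insert e X)) (F.lab S) (F.lab (insert e S)) (F.lab T) (F.lab (insert e T))) := by
    unfold nested nbKernel
    simp only [mul_sum, ← sum_sub_distrib]
  have hsym := six_mul_nested_codes_eq W F.lab (fun X => F.lab (insert e X)) nbKernel
  have hpos : 0 ≤ nested W (fun X S T =>
      nbKernel (F.lab X) (F.lab (insert e X)) (F.lab S) (F.lab (insert e S)) (F.lab T) (F.lab (insert e T))
        + nbKernel (F.lab X) (F.lab (insert e X)) (F.lab T) (F.lab (insert e T)) (F.lab S) (F.lab (insert e S))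
        + nbKernel (F.lab S) (F.lab (insert e S)) (F.lab X) (F.lab (insert e X)) (F.lab T) (F.lab (insert e T))
        + nbKernel (F.lab S) (F.lab (insert e S)) (F.lab T) (F.lab (insert e T)) (F.lab X) (F.lab (insert e X))
        + nbKernel (F.lab T) (F.lab (insert e T)) (F.lab X) (F.lab (insert e X)) (F.lab S) (F.lab (insert e S))
        + nbKernel (F.lab T) (F.lab (insert e T)) (F.lab S) (F.lab (insert e S)) (F.lab X) (F.lab (insert e X))) := by
    unfold nested
    refine sum_nonneg fun X hX => sum_nonneg fun S hS => ?_
    have hXW : X ⊆ W := mem_powerset.1 hX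
    have hSW : S ⊆ W := (mem_powerset.1 hS).trans sdiff_subset
    have hTW : (W \ X) \ S ⊆ W := sdiff_subset.trans sdiff_subset
    exact nbSymm_nonneg_code _ _ _ _ _ _
      (nbCode_of_conds _ _ (F.lab_mono (subset_insert e X)) (hnb X hXW))
      (nbCode_of_conds _ _ (F.lab_mono (subset_insert e S)) (hnb S hSW))
      (nbCode_of_conds _ _ (F.lab_mono (subset_insert e _)) (hnb _ hTW))
  have h6 : 0 ≤ 6 * nested W (fun X S T =>
      nbKernel (F.lab X) (F.lab (insert e X)) (F.lab S) (F.lab (insert e S)) (F.lab T) (F.lab (insert e T))) := by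
    rw [hsym]; exact hpos
  linarith

/-- **Upper section never bottom** (this work): `e ∉ W`, `lab (insert e X) ≠ 0` for all `X ⊆ W` (e.g. `lab {e} ≠ 0`) ⟹
`F.ZP W ∅ ∅ ∅ + (F.con e).ZP W ∅ ∅ ∅ ≤ F.ZP (insert e W) ∅ ∅ ∅` (`b₀ + b₃ ≤ 3b₁`). -/
theorem ZP_add_con_le_of_upper_ne_zero {β : Type*} [Fintype β] [DecidableEq β] (F : Sunflower β) (W : Finset β) (e : β) (he : e ∉ W)
    (hnb : ∀ X, X ⊆ W → F.lab (insert e X) ≠ 0) :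
    F.ZP W ∅ ∅ ∅ + (F.con e).ZP W ∅ ∅ ∅ ≤ F.ZP (insert e W) ∅ ∅ ∅ := by
  rw [F.con_ZP_eq, ← F.nested_con_eq_ZP, F.ZP_empty_eq_nested, F.ZP_empty_eq_nested, F.nested_insert_eq W e he]
  have h1 := F.nested_upperNeZero_le W e hnb
  have h2 := F.spectator_upper_gladkov_nonneg W e (fun y => if y = 4 then (3 : ℤ) else 0) (fun y => by split_ifs <;> norm_num)
  have h3 := F.spectator_con_gladkov_nonneg W e
    (fun x y => (if x = 0 ∧ (y = 1 ∨ y = 2 ∨ y = 3) then (3 : ℤ) else 0) + (if (x = 1 ∨ x = 2 ∨ x = 3) ∧ y = x then (1 : ℤ) else 0))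
    (fun x y => by split_ifs <;> norm_num)
  linarith

/-- Same at a non-bottom singleton (this work): `lab {e} ≠ 0` ⟹ `b₀ + b₃ ≤ 3b₁`, strengthening `ZP_le_ZP_insert_of_lab_singleton_ne_zero`. -/
theorem ZP_add_con_le_of_lab_singleton_ne_zero {β : Type*} [Fintype β] [DecidableEq β] (F : Sunflower β) (W : Finset β) (e : β) (he : e ∉ W)
    (hv : F.lab {e} ≠ 0) : F.ZP W ∅ ∅ ∅ + (F.con e).ZP W ∅ ∅ ∅ ≤ F.ZP (insert e W) ∅ ∅ ∅ := by
  refine F.ZP_add_con_le_of_upper_ne_zero W e he fun X _ h0 => hv ?_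
  have hm := F.lab_mono (show ({e} : Finset β) ⊆ insert e X from singleton_subset_iff.2 (mem_insert_self e X))
  rcases hm with h | h | h
  · rw [h, h0]
  · exact h
  · rw [h] at h0; exact absurd h0 (by decide)

end Sunflower

/-! ## The weighted good-coordinate induction principle -/

/-- **Weighted good-coordinate principle** (this work): if every sunflower has, on every non-empty sub-cube `W`, a coordinate `e ∈ W` and weights
`a ≥ 1`, `c ≥ 0` with `a · F.ZP (W.erase e) ∅ ∅ ∅ + c · (F.con e).ZP (W.erase e) ∅ ∅ ∅ ≤ F.ZP W ∅ ∅ ∅`, then ★ holds (strong induction on `|W|`, using the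
hypothesis for both sections).  The principle of `…SunflowerGoodCoordinate` is the case `(a,c) ∈ {(1,0),(2,1)}`; the scan's classes supply `(1,1), (1,2), (2,0), (3,0)`. -/
theorem partitionLemmaH_of_weightedGoodCoordinates
    (hgood : ∀ (β : Type) [Fintype β] [DecidableEq β] (F : Sunflower β) (W : Finset β), W.Nonempty →
      ∃ e ∈ W, ∃ a c : ℕ, 1 ≤ a ∧ (a : ℤ) * F.ZP (W.erase e) ∅ ∅ ∅ + (c : ℤ) * (F.con e).ZP (W.erase e) ∅ ∅ ∅ ≤ F.ZP W ∅ ∅ ∅) :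
    PartitionLemmaH := by
  have key : ∀ (n : ℕ) (β : Type) [Fintype β] [DecidableEq β] (F : Sunflower β) (W : Finset β), W.card = n → 0 ≤ F.ZP W ∅ ∅ ∅ := by
    intro n
    induction n using Nat.strong_induction_on with
    | _ n ih =>
      intro β _ _ F W hW
      rcases W.eq_empty_or_nonempty with hE | hne
      · subst hE; rw [F.ZP_empty]
      · obtain ⟨e, he, a, c, _, h⟩ := hgood β F W hne
        have hcard : (W.erase e).card = n - 1 := by rw [card_erase_of_mem he, hW]
        have hlt : n - 1 < n := by
          have : 0 < n := by rw [← hW]; exact card_pos.2 hne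
          omega
        have ih1 := ih (n - 1) hlt β F (W.erase e) hcard
        have ih2 := ih (n - 1) hlt β (F.con e) (W.erase e) hcard
        have ha : (0 : ℤ) ≤ (a : ℤ) * F.ZP (W.erase e) ∅ ∅ ∅ := mul_nonneg (by positivity) ih1
        have hc : (0 : ℤ) ≤ (c : ℤ) * (F.con e).ZP (W.erase e) ∅ ∅ ∅ := mul_nonneg (by positivity) ih2
        linarith
  intro β _ _ F
  rw [← F.ZP_univ_empty]
  exact key _ β F univ rfl

end Summit.CriticalPhenomena.PercolationContinuityZ3.Theorems.SunflowerPartition
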